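import Summits.AtomisticToContinuum.Crystallization.Theorems.OverbindingBudgetRegularityCutLimit

/-!
# OverbindingBudget — `μ`-ground states are closed under two-way local limits (`MuGSCLimitClosed`, proved); the blow-down
made unconditional
(helper, `--supports stmt-AtomisticToContinuum-31280`; decomp-a2c lens 4 «minimal counterexample / extremal reduction», generation 24; node
«RegularityCut», file 3)

Files 1–2 (`…RegularityCutStatements`, `…RegularityCutLimit`) reduced the regularity piece of the node to the Liouville statement
`CleanLiouville T₀ D` MODULO the closure hypothesis `MuGSCLimitClosed` (a two-way local limit of `δ`-separated `μ`-ground states of the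
Lennard-Jones potential at chemical potential `e` is a `μ`-ground state at `e`).  This file PROVES that hypothesis over
`Literature…MuGSC` (§J, `muGSCLimitClosed`; the sibling import world has it as `…RepetitiveNetworkReductionRecurrentMember.isMuGSC_of_limit`
over `BallMatch`/`MuGroundStateConfiguration`, which cannot be imported next to `Literature…MuGSC`), and records the unconditional forms
`cleanRegularity_of_cleanLiouville'`, `muCleanBalls_of_gross_liouville'`, `rdef_of_gross_liouville_coherent'` (§K).

PROOF (§J, the sibling argument re-assembled over this world's tools).  Given a finite modification (remove the distinct sites `xf i ∈ Z`,
insert the distinct sites `R j ∉ Z ∖ xf`) of the limit `Z`, match the removed sites to sites `x_m i` of fine approximants `Zs (κ m)`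
(`Match (1/(m+1)) (m + M + 1) 0`), keep the inserted ones (eventually off the approximant: a site of `Z` would otherwise lie within `1/(m+1)`
of `R j ∉ Z`, which is at positive distance from the separated `Z`), apply the approximant's inequality, and pass to the limit: the finite
interaction energies converge by continuity of `V_LJ` off `0` (`continuousOn_lennardJones`), and each field sum
`Σ'_{q ∈ Zs(κ m) ∖ x_m} V_LJ(|w_m − q|) → Σ'_{q ∈ Z ∖ xf} V_LJ(|w₀ − q|)` (`w_m = x_m i → xf i`, or `w_m = R j` constant) by §I
`tendsto_field_of_matched` — which is generation 21's TWO-SET PATCH CONTINUITY of the binding field (`…PatchContinuityTwo.field_continuity₂`)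
applied to the sets with the probe point INSERTED (`insert w₀ (Z ∖ xf)`, `insert w_m (Zs(κ m) ∖ x_m)`: still separated, since the probe point
is at positive distance from the rest; the probe's own term is `V_LJ(0) = 0`, `lennardJones_zero`).  All proofs complete (0 sorry).
-/

namespace Summit.AtomisticToContinuum.Crystallization.Theorems.OverbindingBudgetMuGSCLimit

open Filter Metric Set Topology
open scoped BigOperators
open Literature.MathematicalPhysics.StatisticalMechanics
open Summit.AtomisticToContinuum.Crystallization.Theses.OverbindingBudget (RobustDefectLimitWindows)
open Summit.AtomisticToContinuum.Crystallization.Theorems.OverbindingBudgetGradedBareness (CleanlessExcessT)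
open Summit.AtomisticToContinuum.Crystallization.Theorems.OverbindingBudgetCoherentCut (CoherentResidual)
open Summit.AtomisticToContinuum.Crystallization.Theorems.OverbindingBudgetPatchContinuityTwo (field_continuity₂)
open Summit.AtomisticToContinuum.Crystallization.Theorems.OverbindingBudgetRegularityCutStatements
open Summit.AtomisticToContinuum.Crystallization.Theorems.OverbindingBudgetRegularityCutLimit

/-! ## §H  Preliminaries -/

/-- A point `w₀` off a `δ`-separated set `X' ⊆ ℝ³` is at positive distance from it (only finitely many sites lie within `1` of `w₀`).
(The sibling world's `…LocalLimitStable.exists_pos_le_dist_of_not_mem`, re-proved: that module imports `…MuGroundStateConfiguration`, which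
cannot be imported next to `Literature…MuGSC`.) [folklore] -/
theorem exists_pos_le_dist_of_not_mem {X' : Set (EuclideanSpace ℝ (Fin 3))} {δ : ℝ} (hδ : 0 < δ)
    (hX' : ∀ p ∈ X', ∀ q ∈ X', p ≠ q → δ ≤ dist p q) {w₀ : EuclideanSpace ℝ (Fin 3)} (hw₀ : w₀ ∉ X') :
    ∃ ρ₀ : ℝ, 0 < ρ₀ ∧ ∀ q ∈ X', ρ₀ ≤ dist w₀ q := by
  classical
  have hfin : (X' ∩ closedBall w₀ 1).Finite := UniformlyDiscrete.finite_inter_closedBall (X := X') ⟨δ, hδ, hX'⟩ w₀ 1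
  by_cases hne : (X' ∩ closedBall w₀ 1).Nonempty
  · obtain ⟨q₀, hq₀, hmin⟩ := hfin.toFinset.exists_min_image (fun q => dist w₀ q)
      ((Set.Finite.toFinset_nonempty hfin).2 hne)
    rw [Set.Finite.mem_toFinset] at hq₀
    have hq₀pos : 0 < dist w₀ q₀ := dist_pos.2 fun h => hw₀ (h ▸ hq₀.1)
    refine ⟨min 1 (dist w₀ q₀), lt_min one_pos hq₀pos, fun q hq => ?_⟩
    by_cases hq1 : dist w₀ q ≤ 1
    · have := hmin q (by
        rw [Set.Finite.mem_toFinset]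
        exact ⟨hq, by rwa [mem_closedBall, dist_comm]⟩)
      exact (min_le_right _ _).trans this
    · exact (min_le_left _ _).trans (not_le.1 hq1).le
  · refine ⟨1, one_pos, fun q hq => ?_⟩
    by_contra h
    exact hne ⟨q, hq, by rw [mem_closedBall, dist_comm]; exact (not_le.1 h).le⟩

/-- The field of a uniformly discrete set at an outside point equals the site field of the set with the point inserted (the own term is
`V_LJ(0) = 0`). [folklore] -/
theorem tsum_insert_lennardJones {S : Set (EuclideanSpace ℝ (Fin 3))} (hS : UniformlyDiscrete S) {w : EuclideanSpace ℝ (Fin 3)}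
    (hw : w ∉ S) :
    ∑' q : ↥(insert w S), lennardJones (dist w (q : EuclideanSpace ℝ (Fin 3))) =
      ∑' q : ↥S, lennardJones (dist w (q : EuclideanSpace ℝ (Fin 3))) := by
  classical
  have hdisj : Disjoint ({w} : Set (EuclideanSpace ℝ (Fin 3))) S := Set.disjoint_singleton_left.2 hw
  have h1 : Summable ((fun q : EuclideanSpace ℝ (Fin 3) => lennardJones (dist w q)) ∘ (↑) : ({w} : Set (EuclideanSpace ℝ (Fin 3))) → ℝ) :=
    (hasSum_fintype _).summable
  have h2 : Summable ((fun q : EuclideanSpace ℝ (Fin 3) => lennardJones (dist w q)) ∘ (↑) : S → ℝ) :=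
    hS.summable_lennardJones w
  have h3 : ∑' q : ↥({w} : Set (EuclideanSpace ℝ (Fin 3))), lennardJones (dist w (q : EuclideanSpace ℝ (Fin 3))) = 0 := by
    rw [tsum_singleton w (fun q : EuclideanSpace ℝ (Fin 3) => lennardJones (dist w q)), dist_self, lennardJones_zero]
  rw [tsum_congr_set_coe (fun q : EuclideanSpace ℝ (Fin 3) => lennardJones (dist w q)) (Set.singleton_union (a := w) (s := S)).symm,
    h1.tsum_union_disjoint hdisj h2, h3, zero_add]

/-! ## §I  Field sums converge along two-way matched separated sets -/

/-- **Field sums at a moving probe point converge along two-way matched separated sets.**  Let `X' ⊆ ℝ³` be `δ`-separated and `w₀` at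
distance `≥ ρ₀ > 0` from `X'`; let `T j` be `δ`-separated and, for every radius `R` and `ε > 0`, eventually two-way `ε`-matched with `X'`
on `B_R(w₀)`; let `w j → w₀`.  Then `Σ'_{q ∈ T j} V_LJ(|w j − q|) → Σ'_{q ∈ X'} V_LJ(|w₀ − q|)`.  Proof: two-set patch continuity
(`field_continuity₂`, generation 21) for the sets with the probe point inserted. [folklore] -/
theorem tendsto_field_of_matched {X' : Set (EuclideanSpace ℝ (Fin 3))} {δ : ℝ} (hδ : 0 < δ)
    (hX' : ∀ p ∈ X', ∀ q ∈ X', p ≠ q → δ ≤ dist p q)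
    {w₀ : EuclideanSpace ℝ (Fin 3)} {ρ₀ : ℝ} (hρ₀ : 0 < ρ₀) (hw₀ : ∀ q ∈ X', ρ₀ ≤ dist w₀ q)
    {T : ℕ → Set (EuclideanSpace ℝ (Fin 3))} (hT : ∀ j, ∀ p ∈ T j, ∀ q ∈ T j, p ≠ q → δ ≤ dist p q)
    {w : ℕ → EuclideanSpace ℝ (Fin 3)} (hw : Tendsto w atTop (𝓝 w₀))
    (hmatch : ∀ R ε : ℝ, 0 < ε → ∀ᶠ j in atTop,
      (∀ p ∈ X', dist p w₀ ≤ R → ∃ q ∈ T j, dist q p ≤ ε) ∧ (∀ q ∈ T j, dist q w₀ ≤ R → ∃ p ∈ X', dist q p ≤ ε)) :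
    Tendsto (fun j => ∑' q : ↥(T j), lennardJones (dist (w j) (q : EuclideanSpace ℝ (Fin 3)))) atTop
      (𝓝 (∑' q : ↥X', lennardJones (dist w₀ (q : EuclideanSpace ℝ (Fin 3))))) := by
  classical
  rw [Metric.tendsto_atTop]
  intro θ hθ
  set δ₁ : ℝ := min (min δ (ρ₀ / 2)) (1 / 2) with hδ₁
  have hδ₁0 : 0 < δ₁ := by positivity
  have hδ₁δ : δ₁ ≤ δ := (min_le_left _ _).trans (min_le_left _ _)
  have hδ₁ρ : δ₁ ≤ ρ₀ / 2 := (min_le_left _ _).trans (min_le_right _ _)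
  have hδ₁h : δ₁ ≤ 1 / 2 := min_le_right _ _
  obtain ⟨R₁, ε₁, hε₁, hcont⟩ := field_continuity₂ hδ₁0 (half_pos hθ)
  have hη : 0 < min (ε₁ / 2) (ρ₀ / 4) := by positivity
  have hev1 := hmatch (|R₁| + 1) _ hη
  have hev2 : ∀ᶠ j in atTop, dist (w j) w₀ < min (ε₁ / 2) (min (ρ₀ / 4) (1 / 2)) :=
    (Metric.tendsto_nhds.1 hw) _ (by positivity)
  obtain ⟨N, hN⟩ := Filter.eventually_atTop.1 (hev1.and hev2)
  refine ⟨N, fun j hj => ?_⟩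
  obtain ⟨⟨hm1, hm2⟩, hwj⟩ := hN j hj
  have hwε : dist (w j) w₀ < ε₁ / 2 := lt_of_lt_of_le hwj (min_le_left _ _)
  have hwρ : dist (w j) w₀ < ρ₀ / 4 := lt_of_lt_of_le hwj ((min_le_right _ _).trans (min_le_left _ _))
  have hwh : dist (w j) w₀ < 1 / 2 := lt_of_lt_of_le hwj ((min_le_right _ _).trans (min_le_right _ _))
  have hw₀X : w₀ ∉ X' := fun h => by have := hw₀ w₀ h; rw [dist_self] at this; linarith
  -- the probe point is uniformly far from the approximant's sites
  have hfar : ∀ q ∈ T j, δ₁ ≤ dist (w j) q := by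
    intro q hq
    by_cases hqR : dist q w₀ ≤ |R₁| + 1
    · obtain ⟨p, hp, hqp⟩ := hm2 q hq hqR
      have h1 := hw₀ p hp
      have h2 : dist q p ≤ ρ₀ / 4 := hqp.trans (min_le_right _ _)
      have h3 := dist_triangle w₀ (w j) q
      have h4 := dist_triangle (w j) q p
      have h5 := dist_triangle w₀ (w j) p
      rw [dist_comm w₀ (w j)] at h3 h5
      linarith
    · push Not at hqR
      have h3 := dist_triangle q (w j) w₀
      rw [dist_comm q (w j)] at h3
      linarith [abs_nonneg R₁]
  have hwT : w j ∉ T j := fun h => by have := hfar (w j) h; rw [dist_self] at this; linarith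
  -- separation of the two sets with the probe points inserted
  have hsepA : ∀ x ∈ insert w₀ X', ∀ z ∈ insert w₀ X', x ≠ z → δ₁ ≤ dist x z := by
    intro x hx z hz hxz
    rcases Set.mem_insert_iff.1 hx with hx1 | hx1
    · rcases Set.mem_insert_iff.1 hz with hz1 | hz1
      · exact absurd (hx1.trans hz1.symm) hxz
      · rw [hx1]; linarith [hw₀ z hz1]
    · rcases Set.mem_insert_iff.1 hz with hz1 | hz1
      · rw [hz1, dist_comm]; linarith [hw₀ x hx1]
      · exact hδ₁δ.trans (hX' x hx1 z hz1 hxz)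
  have hsepB : ∀ x ∈ insert (w j) (T j), ∀ z ∈ insert (w j) (T j), x ≠ z → δ₁ ≤ dist x z := by
    intro x hx z hz hxz
    rcases Set.mem_insert_iff.1 hx with hx1 | hx1
    · rcases Set.mem_insert_iff.1 hz with hz1 | hz1
      · exact absurd (hx1.trans hz1.symm) hxz
      · rw [hx1]; exact hfar z hz1
    · rcases Set.mem_insert_iff.1 hz with hz1 | hz1
      · rw [hz1, dist_comm]; exact hfar x hx1
      · exact hδ₁δ.trans (hT j x hx1 z hz1 hxz)
  -- the two patches are matched
  have hvec : ∀ q p : EuclideanSpace ℝ (Fin 3), dist (q - w j) (p - w₀) ≤ dist q p + dist (w j) w₀ := by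
    intro q p
    rw [dist_eq_norm, dist_eq_norm, dist_eq_norm]
    have e : q - w j - (p - w₀) = (q - p) - (w j - w₀) := by abel
    rw [e]
    exact norm_sub_le _ _
  have hfwd : ∀ y ∈ insert w₀ X', dist y w₀ ≤ R₁ → ∃ y' ∈ insert (w j) (T j), dist (y' - w j) (y - w₀) ≤ ε₁ := by
    intro y hy hyR
    rcases Set.mem_insert_iff.1 hy with rfl | hy
    · exact ⟨w j, Set.mem_insert _ _, by rw [sub_self, sub_self, dist_self]; exact hε₁.le⟩
    · obtain ⟨q, hq, hqp⟩ := hm1 y hy (hyR.trans (by linarith [le_abs_self R₁]))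
      refine ⟨q, Set.mem_insert_of_mem _ hq, ?_⟩
      have := hvec q y
      linarith [hqp.trans (min_le_left _ _)]
  have hbwd : ∀ y' ∈ insert (w j) (T j), dist y' (w j) ≤ R₁ → ∃ y ∈ insert w₀ X', dist (y' - w j) (y - w₀) ≤ ε₁ := by
    intro y' hy' hy'R
    rcases Set.mem_insert_iff.1 hy' with rfl | hy'
    · exact ⟨w₀, Set.mem_insert _ _, by rw [sub_self, sub_self, dist_self]; exact hε₁.le⟩
    · have hy'R' : dist y' w₀ ≤ |R₁| + 1 := by
        have := dist_triangle y' (w j) w₀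
        linarith [le_abs_self R₁]
      obtain ⟨p, hp, hqp⟩ := hm2 y' hy' hy'R'
      refine ⟨p, Set.mem_insert_of_mem _ hp, ?_⟩
      have := hvec y' p
      linarith [hqp.trans (min_le_left _ _)]
  have hc := hcont (insert w₀ X') (insert (w j) (T j)) hsepA hsepB w₀ (Set.mem_insert _ _) (w j) (Set.mem_insert _ _) hfwd hbwd
  rw [tsum_insert_lennardJones ⟨δ, hδ, hT j⟩ hwT, tsum_insert_lennardJones ⟨δ, hδ, hX'⟩ hw₀X] at hc
  rw [Real.dist_eq]
  linarith [abs_nonneg (∑' q : ↥(T j), lennardJones (dist (w j) (q : EuclideanSpace ℝ (Fin 3))) -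
    ∑' q : ↥X', lennardJones (dist w₀ (q : EuclideanSpace ℝ (Fin 3))))]

/-! ## §J  `μ`-ground states are closed under two-way local limits -/

/-- **`MuGSCLimitClosed` holds** (the hypothesis of file 2, discharged): the renormalised finite-modification inequalities `IsMuGSC
lennardJones e` pass to two-way local limits of `δ`-separated configurations.  Match the removed sites to sites of fine approximants,
keep the inserted ones, apply the inequality there and pass to the limit (finite energies by continuity of `V_LJ` off `0`, field sums
by `tendsto_field_of_matched`). [folklore; port of the sibling world's `isMuGSC_of_limit`] -/
theorem muGSCLimitClosed : MuGSCLimitClosed := by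
  classical
  intro e δ hδ Zs Z hZsep hZM hsep hconv
  refine (isMuGSC_iff _ _ _).2 ⟨fun r => UniformlyDiscrete.summable_lennardJones ⟨δ, hδ, hsep⟩ r, ?_⟩
  intro n xf hxf hxfZ k R hR hdisj
  have hε : ∀ m : ℕ, (0 : ℝ) < 1 / ((m : ℝ) + 1) := fun m => by positivity
  -- a common bound on the norms of the finitely many points involved
  set M : ℝ := ∑ i, ‖xf i‖ + ∑ j, ‖R j‖ with hM
  have hMx : ∀ i, ‖xf i‖ ≤ M := fun i => by
    have h1 : ‖xf i‖ ≤ ∑ i, ‖xf i‖ := Finset.single_le_sum (fun i _ => norm_nonneg (xf i)) (Finset.mem_univ i)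
    have h2 : (0 : ℝ) ≤ ∑ j, ‖R j‖ := Finset.sum_nonneg fun j _ => norm_nonneg _
    linarith
  have hMR : ∀ j, ‖R j‖ ≤ M := fun j => by
    have h1 : ‖R j‖ ≤ ∑ j, ‖R j‖ := Finset.single_le_sum (fun j _ => norm_nonneg (R j)) (Finset.mem_univ j)
    have h2 : (0 : ℝ) ≤ ∑ i, ‖xf i‖ := Finset.sum_nonneg fun i _ => norm_nonneg _
    linarith
  obtain ⟨κ, hκ⟩ : ∃ κ : ℕ → ℕ, ∀ m : ℕ, Match (1 / ((m : ℝ) + 1)) ((m : ℝ) + M + 1) 0 (Zs (κ m)) Z :=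
    ⟨fun m => (hconv ((m : ℝ) + M + 1) _ (hε m)).exists.choose,
      fun m => (hconv ((m : ℝ) + M + 1) _ (hε m)).exists.choose_spec⟩
  have hrad : ∀ m : ℕ, ∀ c q : EuclideanSpace ℝ (Fin 3), ‖c‖ ≤ M → dist q c ≤ m →
      dist q (0 : EuclideanSpace ℝ (Fin 3)) ≤ (m : ℝ) + M + 1 := by
    intro m c q hc hqc
    have h1 := dist_triangle q c (0 : EuclideanSpace ℝ (Fin 3))
    have e1 : dist c (0 : EuclideanSpace ℝ (Fin 3)) = ‖c‖ := dist_zero_right _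
    linarith
  have hx0 : ∀ m : ℕ, ∀ i, dist (xf i) (0 : EuclideanSpace ℝ (Fin 3)) ≤ (m : ℝ) + M + 1 := fun m i =>
    hrad m (xf i) (xf i) (hMx i) (by rw [dist_self]; exact Nat.cast_nonneg m)
  obtain ⟨x, hxZ, hxd⟩ : ∃ x : ℕ → Fin n → EuclideanSpace ℝ (Fin 3), (∀ m i, x m i ∈ Zs (κ m)) ∧
      ∀ (m : ℕ) i, dist (x m i) (xf i) ≤ 1 / ((m : ℝ) + 1) := by
    choose x h1 h2 using fun (m : ℕ) (i : Fin n) => (hκ m).1 (xf i) (hxfZ ⟨i, rfl⟩) (hx0 m i)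
    exact ⟨x, h1, h2⟩
  -- inserted atoms outside `Z` are eventually outside the approximants
  have hRout : ∀ᶠ m : ℕ in atTop, ∀ j, R j ∉ Z → R j ∉ Zs (κ m) := by
    rw [Filter.eventually_all]
    intro j
    by_cases hj : R j ∈ Z
    · exact Filter.Eventually.of_forall fun m h => (h hj).elim
    · obtain ⟨ρ, hρ, hρZ⟩ := exists_pos_le_dist_of_not_mem hδ hsep hj
      filter_upwards [(tendsto_one_div_add_atTop_nhds_zero_nat.eventually (gt_mem_nhds hρ))] with m hm _ hRj
      obtain ⟨s, hs, hds⟩ := (hκ m).2 (R j) hRj (hrad m (R j) (R j) (hMR j) (by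
        rw [dist_self]; exact Nat.cast_nonneg m))
      have := hρZ s hs
      linarith
  -- the inequality at stage `m`, eventually
  have hstage : ∀ᶠ m : ℕ in atTop,
      interactionEnergy lennardJones (x m) +
          (∑ i, ∑' q : ↥(Zs (κ m) \ Set.range (x m)), lennardJones (dist (x m i) (q : EuclideanSpace ℝ (Fin 3)))) -
          e * n ≤
        interactionEnergy lennardJones R +
          (∑ i, ∑' q : ↥(Zs (κ m) \ Set.range (x m)), lennardJones (dist (R i) (q : EuclideanSpace ℝ (Fin 3)))) -
          e * k := by
    filter_upwards [(tendsto_one_div_add_atTop_nhds_zero_nat.eventually (gt_mem_nhds (half_pos hδ))), hRout] with m hm hmR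
    have hmδ : 2 * (1 / ((m : ℝ) + 1)) < δ := by linarith
    have hxinj : Function.Injective (x m) := by
      intro i i' h
      by_contra hne
      have h1 := hsep (xf i) (hxfZ ⟨i, rfl⟩) (xf i') (hxfZ ⟨i', rfl⟩) (hxf.ne hne)
      have : dist (xf i) (xf i') ≤ 2 * (1 / ((m : ℝ) + 1)) :=
        calc dist (xf i) (xf i') ≤ dist (x m i) (xf i) + dist (x m i) (xf i') := dist_triangle_left _ _ _
          _ = dist (x m i) (xf i) + dist (x m i') (xf i') := by rw [h]
          _ ≤ 1 / ((m : ℝ) + 1) + 1 / ((m : ℝ) + 1) := add_le_add (hxd m i) (hxd m i')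
          _ = 2 * (1 / ((m : ℝ) + 1)) := by ring
      linarith
    have hxr : Set.range (x m) ⊆ Zs (κ m) := by
      rintro _ ⟨i, rfl⟩; exact hxZ m i
    have hdisj' : Disjoint (Set.range R) (Zs (κ m) \ Set.range (x m)) := by
      rw [Set.disjoint_left]
      rintro _ ⟨j, rfl⟩ ⟨hRjZs, hRjx⟩
      by_cases hRjZ : R j ∈ Z
      · have hRjxf : R j ∈ Set.range xf := by
          by_contra hnot
          exact (Set.disjoint_left.1 hdisj) ⟨j, rfl⟩ ⟨hRjZ, hnot⟩
        obtain ⟨i, hi⟩ := hRjxf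
        apply hRjx
        refine ⟨i, ?_⟩
        by_contra hne
        have h1 := hZsep (κ m) (x m i) (hxZ m i) (R j) hRjZs hne
        have h2 : dist (x m i) (R j) ≤ 1 / ((m : ℝ) + 1) := by rw [← hi]; exact hxd m i
        linarith [hε m]
      · exact hmR j hRjZ hRjZs
    exact ((isMuGSC_iff _ _ _).1 (hZM (κ m))).2 n (x m) hxinj hxr k R hR hdisj'
  -- two-way matching of the rests about any centre of norm `≤ M`
  have hX'sep : ∀ a ∈ Z \ Set.range xf, ∀ b ∈ Z \ Set.range xf, a ≠ b → δ ≤ dist a b :=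
    fun a ha b hb hab => hsep a ha.1 b hb.1 hab
  have hTsep : ∀ m, ∀ a ∈ Zs (κ m) \ Set.range (x m), ∀ b ∈ Zs (κ m) \ Set.range (x m), a ≠ b → δ ≤ dist a b :=
    fun m a ha b hb hab => hZsep _ a ha.1 b hb.1 hab
  have hmatch : ∀ c : EuclideanSpace ℝ (Fin 3), ‖c‖ ≤ M → ∀ R' ε : ℝ, 0 < ε → ∀ᶠ m : ℕ in atTop,
      (∀ q ∈ Z \ Set.range xf, dist q c ≤ R' → ∃ q' ∈ Zs (κ m) \ Set.range (x m), dist q' q ≤ ε) ∧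
        (∀ q' ∈ Zs (κ m) \ Set.range (x m), dist q' c ≤ R' → ∃ q ∈ Z \ Set.range xf, dist q' q ≤ ε) := by
    intro c hc R' ε' he
    filter_upwards [(tendsto_one_div_add_atTop_nhds_zero_nat.eventually (gt_mem_nhds (lt_min he (half_pos hδ)))),
      (tendsto_natCast_atTop_atTop.eventually_ge_atTop R')] with m hm1 hm2
    have hme : 1 / ((m : ℝ) + 1) ≤ ε' := (hm1.trans_le (min_le_left _ _)).le
    have hmδ : 2 * (1 / ((m : ℝ) + 1)) < δ := by
      have := hm1.trans_le (min_le_right _ _); linarith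
    refine ⟨fun q hq hqc => ?_, fun q' hq' hq'c => ?_⟩
    · obtain ⟨q', hq', hq'q⟩ := (hκ m).1 q hq.1 (hrad m c q hc (hqc.trans hm2))
      have hne : q' ∉ Set.range (x m) := by
        rintro ⟨i, rfl⟩
        have hqx : q ≠ xf i := fun h => hq.2 ⟨i, h.symm⟩
        have h3 := hsep q hq.1 (xf i) (hxfZ ⟨i, rfl⟩) hqx
        have : dist q (xf i) ≤ 2 * (1 / ((m : ℝ) + 1)) :=
          calc dist q (xf i) ≤ dist (x m i) q + dist (x m i) (xf i) := dist_triangle_left _ _ _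
            _ ≤ 1 / ((m : ℝ) + 1) + 1 / ((m : ℝ) + 1) := add_le_add hq'q (hxd m i)
            _ = 2 * (1 / ((m : ℝ) + 1)) := by ring
        linarith
      exact ⟨q', ⟨hq', hne⟩, hq'q.trans hme⟩
    · obtain ⟨q, hq, hq'q⟩ := (hκ m).2 q' hq'.1 (hrad m c q' hc (hq'c.trans hm2))
      have hqx : q ∉ Set.range xf := by
        rintro ⟨i, rfl⟩
        have hne : q' ≠ x m i := fun h => hq'.2 ⟨i, h.symm⟩
        have h3 := hZsep (κ m) q' hq'.1 (x m i) (hxZ m i) hne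
        have : dist q' (x m i) ≤ 2 * (1 / ((m : ℝ) + 1)) :=
          calc dist q' (x m i) ≤ dist q' (xf i) + dist (x m i) (xf i) := dist_triangle_right _ _ _
            _ ≤ 1 / ((m : ℝ) + 1) + 1 / ((m : ℝ) + 1) := add_le_add hq'q (hxd m i)
            _ = 2 * (1 / ((m : ℝ) + 1)) := by ring
        linarith
      exact ⟨q, ⟨hq, hqx⟩, hq'q.trans hme⟩
  -- limits
  have hxt : ∀ i, Tendsto (fun m => x m i) atTop (𝓝 (xf i)) := fun i => by
    -- (the sibling world's `tendsto_of_dist_le_one_div`, inlined: that module is not importable here)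
    rw [tendsto_iff_dist_tendsto_zero]
    exact squeeze_zero (fun m => dist_nonneg) (fun m => hxd m i) tendsto_one_div_add_atTop_nhds_zero_nat
  have hIE : Tendsto (fun m => interactionEnergy lennardJones (x m)) atTop
      (𝓝 (interactionEnergy lennardJones xf)) := by
    simp only [interactionEnergy]
    refine tendsto_finsetSum _ fun i _ => tendsto_finsetSum _ fun j hj => ?_
    have hij : i ≠ j := (Finset.mem_Ioi.1 hj).ne
    have hd : dist (xf i) (xf j) ≠ 0 := dist_ne_zero.2 (hxf.ne hij)
    have hc : ContinuousAt lennardJones (dist (xf i) (xf j)) :=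
      continuousOn_lennardJones.continuousAt (isOpen_compl_singleton.mem_nhds hd)
    exact hc.tendsto.comp ((hxt i).dist (hxt j))
  have hF1 : ∀ i, Tendsto
      (fun m => ∑' q : ↥(Zs (κ m) \ Set.range (x m)), lennardJones (dist (x m i) (q : EuclideanSpace ℝ (Fin 3))))
      atTop (𝓝 (∑' q : ↥(Z \ Set.range xf), lennardJones (dist (xf i) (q : EuclideanSpace ℝ (Fin 3))))) := by
    intro i
    have hρ : ∀ q ∈ Z \ Set.range xf, δ ≤ dist (xf i) q :=
      fun q hq => hsep (xf i) (hxfZ ⟨i, rfl⟩) q hq.1 fun h => hq.2 ⟨i, h⟩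
    exact tendsto_field_of_matched hδ hX'sep hδ hρ hTsep (hxt i) (hmatch (xf i) (hMx i))
  have hF2 : ∀ j, Tendsto
      (fun m => ∑' q : ↥(Zs (κ m) \ Set.range (x m)), lennardJones (dist (R j) (q : EuclideanSpace ℝ (Fin 3))))
      atTop (𝓝 (∑' q : ↥(Z \ Set.range xf), lennardJones (dist (R j) (q : EuclideanSpace ℝ (Fin 3))))) := by
    intro j
    have hRj : R j ∉ Z \ Set.range xf := fun h => (Set.disjoint_left.1 hdisj) ⟨j, rfl⟩ h
    obtain ⟨ρ, hρ, hρX⟩ := exists_pos_le_dist_of_not_mem hδ hX'sep hRj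
    exact tendsto_field_of_matched hδ hX'sep hρ hρX hTsep tendsto_const_nhds (hmatch (R j) (hMR j))
  have hL := (hIE.add (tendsto_finsetSum Finset.univ fun i _ => hF1 i)).sub
    (tendsto_const_nhds : Tendsto (fun _ : ℕ => e * (n : ℝ)) atTop (𝓝 (e * n)))
  have hRl := ((tendsto_const_nhds : Tendsto (fun _ : ℕ => interactionEnergy lennardJones R) atTop
      (𝓝 (interactionEnergy lennardJones R))).add (tendsto_finsetSum Finset.univ fun j _ => hF2 j)).sub
    (tendsto_const_nhds : Tendsto (fun _ : ℕ => e * (k : ℝ)) atTop (𝓝 (e * k)))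
  exact le_of_tendsto_of_tendsto hL hRl hstage

/-! ## §K  The unconditional forms -/

/-- **The blow-down, unconditional.**  `CleanLiouville T₀ D → CleanRegularity T₀ D` (`0 ≤ T₀`). [this file] -/
theorem cleanRegularity_of_cleanLiouville' {T₀ D : ℝ} (hT₀ : 0 ≤ T₀) (hL : CleanLiouville T₀ D) : CleanRegularity T₀ D :=
  cleanRegularity_of_cleanLiouville hT₀ muGSCLimitClosed hL

/-- `GrossCleanBalls T₀ D → CleanLiouville T₀ D → MuCleanBalls D` (`0 < T₀`), unconditional. [this file] -/
theorem muCleanBalls_of_gross_liouville' {T₀ D : ℝ} (hT : 0 < T₀) (hG : GrossCleanBalls T₀ D) (hL : CleanLiouville T₀ D) :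
    MuCleanBalls D :=
  muCleanBalls_of_gross_liouville hT hG hL muGSCLimitClosed

/-- **The cone of the node, unconditional.**  `GrossCleanBalls T₀ 10 → CleanLiouville T₀ 10 → CleanlessExcessT → CoherentResidual 10 →
RobustDefectLimitWindows` (`T₀ > 0`; recommended `T₀ = 1/250`). [this file] -/
theorem rdef_of_gross_liouville_coherent' {T₀ : ℝ} (hT : 0 < T₀) (hG : GrossCleanBalls T₀ 10) (hL : CleanLiouville T₀ 10)
    (hCE : CleanlessExcessT) (hR : CoherentResidual 10) : RobustDefectLimitWindows :=
  rdef_of_gross_liouville_coherent hT hG hL muGSCLimitClosed hCE hR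

end Summit.AtomisticToContinuum.Crystallization.Theorems.OverbindingBudgetMuGSCLimit
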